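import Mathlib

/-!
# A kernel-checked counterexample: the `(2,2)` star slices of a degree-4 non-mark `d` with four
distinct NON-MARK neighbours are not sign-definite, nor their pairing sums, nor the level sum
(blind cell PercRepro2, p3 g27, 2026-08-28; `proofs/P3-POCKET.md` §2)

The single-`d` sum `dSignSum(d) = Σ_{ω ∈ Sep, D(ω) ⊆ {d}} σ_pq · σ_rs` splits by the colour pattern
`c ∈ {Y, W}^{E_d}` of the star of `d` into the star slices `S(c)`.  For `deg d = 3` every mixed slice
is a single-edge slice of a `DZero` sum and `dSignSum ≤ 0` follows (class `C3`, `M9DegreeThree`); for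
`deg d = 4` the six `(2,2)` patterns are two-star slices `Sl(G − d + x_ix_j + x_kx_l; x_ix_j = Y,
x_kx_l = W)`, conjectured non-positive when the four neighbours are non-marks.  This file checks in
the kernel that they are NOT: on the graph `G₉` on the vertices `0..8` with marks `p, q, r, s = 0, 1,
2, 3`, the non-mark `d = 4` of degree `4` with the four distinct non-mark neighbours `8, 5, 7, 6`, and
the ten edges

  `e₀ = {4,8}, e₁ = {4,5}, e₂ = {4,7}, e₃ = {4,6}, e₄ = {1,8}, e₅ = {2,6}, e₆ = {0,5}, e₇ = {7,5},
   e₈ = {3,6}, e₉ = {0,7}`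

(all weights `1/2`; `6` is adjacent to both `r` and `s`, `5` and `7` to `p`, `8` to `q`), the sixteen
pattern sums `S(c)` over `c = (ω e₀, ω e₁, ω e₂, ω e₃)` (index `Σ 2^i · ω e_i`) are

  `[-6, 0, -5, 2, -5, 2, 0, 0, 0, 0, 2, -5, 2, -5, 0, -6]`:

the slices `S(d8 d5 = Y; d7 d6 = W) = S(3) = 2`, `S(d8 d7 = Y; d5 d6 = W) = S(5) = 2`,
`S(d5 d6 = Y; d8 d7 = W) = S(10) = 2`, `S(d7 d6 = Y; d8 d5 = W) = S(12) = 2` are POSITIVE, the pairing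
sums `S(3) + S(12) = S(5) + S(10) = 4` are positive, the level sum `LEVEL(2) = Σ_{|c|_Y = 2} S(c) = 8`
is positive, while `dSignSum(4) = Σ_c S(c) = −24` (all of it the `DZero` part: no colouring of `G₉` in
`Sep` has `d` doubly reached).  So a proof of the degree-4 case cannot go slice by slice, pairing by
pairing, or level by level: the `(2,2)` excess `+8` is paid by the all-`Y`/all-`W` slices (`−12`) and
the one-`W`/one-`Y` slices (`−20`) jointly.

Model: colourings are `c ∈ [0, 2^10)` (bit `i` set ⟺ `e_i` is `Y` = open); clusters are bitmasks over
`0..8`, computed by nine expansion steps along the open (resp. closed) edges; `K = C_Y(r) ∪ C_Y(s)`,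
`M = C_W(r) ∪ C_W(s)`, `Sep ⟺ p, q ∉ K ∪ M`, `DOne(d) ⟺ (K ∩ M) ∖ {r, s, d} = ∅`,
`σ_ab = 1[a ~_Y b] − 1[a ~_W b]`.  The sixteen sums are established by `decide +kernel` (standard
axioms only); the sign statements follow by `norm_num` / `decide`.  Found by the cell's exact census
(data/p3/g27/, two independent codes: `perc.py` and `check_w2.py`).  Own work.
-/

namespace Summit.Ventures.PercRepro2.SliceCounterexample

/-- The ten edges of the witness graph `G₉` (vertices `0..8`), as pairs; `e₀..e₃` are the star of `d = 4`. -/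
def edge : Nat → Nat × Nat
  | 0 => (4, 8)
  | 1 => (4, 5)
  | 2 => (4, 7)
  | 3 => (4, 6)
  | 4 => (1, 8)
  | 5 => (2, 6)
  | 6 => (0, 5)
  | 7 => (7, 5)
  | 8 => (3, 6)
  | _ => (0, 7)

/-- The marks. -/
def p : Nat := 0
/-- The second mark of the first pair. -/
def q : Nat := 1
/-- The first mark of the second pair. -/
def r : Nat := 2
/-- The second mark of the second pair. -/
def s : Nat := 3
/-- The non-mark `d` of degree `4`. -/
def d : Nat := 4

/-- Edge `i` is `Y` (open) in the colouring `c ∈ [0, 2^10)` iff bit `i` of `c` is set. -/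
def isY (c i : Nat) : Bool := c.testBit i

/-- Vertex sets are bitmasks over `0..8`; `mem S x` is `x ∈ S`. -/
def mem (S x : Nat) : Bool := S.testBit x

/-- One expansion step of a vertex set along the edges of the colour `col` (`true` = `Y`). -/
def step (col : Bool) (c S : Nat) : Nat :=
  (List.range 10).foldl (fun S i =>
    let e := edge i
    if isY c i == col then
      let S₁ := if mem S e.1 then S ||| (1 <<< e.2) else S
      if mem S₁ e.2 then S₁ ||| (1 <<< e.1) else S₁
    else S) S

/-- `n`-fold iteration of `step col c`. -/
def iter (col : Bool) (c : Nat) : Nat → Nat → Nat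
  | 0, S => S
  | n + 1, S => iter col c n (step col c S)

/-- The cluster of the vertex `v` in the colour `col` (nine steps suffice on nine vertices). -/
def cluster (col : Bool) (c v : Nat) : Nat := iter col c 9 (1 <<< v)

/-- `σ_ab(c) = 1[a ~_Y b] − 1[a ~_W b]`. -/
def sigma (c a b : Nat) : Int :=
  (if mem (cluster true c a) b then 1 else 0) - (if mem (cluster false c a) b then 1 else 0)

/-- The `Y`-world `K = C_Y(r) ∪ C_Y(s)` of `{r, s}`. -/
def K (c : Nat) : Nat := cluster true c r ||| cluster true c s
/-- The `W`-world `M = C_W(r) ∪ C_W(s)` of `{r, s}`. -/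
def M (c : Nat) : Nat := cluster false c r ||| cluster false c s

/-- The colouring is `Sep ∧ DOne(d)`: `p, q ∉ K ∪ M` and no vertex other than `r, s, d` lies in `K ∩ M`
(`483 = 2^9 − 1 − 2^r − 2^s − 2^d` is the mask of the vertices other than `r, s, d`). -/
def legal (c : Nat) : Bool :=
  let KM := K c ||| M c
  !(mem KM p) && !(mem KM q) && ((K c &&& M c) &&& 483 == 0)

/-- The star pattern of `d` in `c`: the four low bits `(ω e₀, ω e₁, ω e₂, ω e₃)` as a number `< 16`. -/
def pattern (c : Nat) : Nat := c % 16

/-- The sixteen pattern sums `S(c) = Σ_{ω legal, pattern ω = c} σ_pq(ω) · σ_rs(ω)`, indexed by the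
pattern, in one pass over the `2^10` colourings. -/
def patternSums : List Int :=
  (List.range 1024).foldl (fun acc c =>
    if legal c then
      acc.set (pattern c) (acc.getD (pattern c) 0 + sigma c p q * sigma c r s)
    else acc) (List.replicate 16 0)

/-- **The sixteen star-pattern sums of `G₉` at `d = 4`.** -/
theorem patternSums_eq :
    patternSums = [-6, 0, -5, 2, -5, 2, 0, 0, 0, 0, 2, -5, 2, -5, 0, -6] := by decide +kernel

/-- The `(2,2)` slice `S(d8 d5 = Y; d7 d6 = W)` (pattern `3 = 0011₂`) is positive. -/
theorem slice_three_pos : 0 < patternSums.getD 3 0 := by rw [patternSums_eq]; decide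

/-- The `(2,2)` slice `S(d8 d7 = Y; d5 d6 = W)` (pattern `5 = 0101₂`) is positive. -/
theorem slice_five_pos : 0 < patternSums.getD 5 0 := by rw [patternSums_eq]; decide

/-- The pairing sums `S(3) + S(12)` and `S(5) + S(10)` (a pattern with its colour flip) are positive. -/
theorem pairing_sums_pos :
    0 < patternSums.getD 3 0 + patternSums.getD 12 0 ∧
      0 < patternSums.getD 5 0 + patternSums.getD 10 0 := by
  rw [patternSums_eq]; decide

/-- The level sum `LEVEL(2) = Σ_{|c|_Y = 2} S(c)` (patterns `3, 5, 6, 9, 10, 12`) is `8 > 0`. -/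
theorem level_two_eq :
    patternSums.getD 3 0 + patternSums.getD 5 0 + patternSums.getD 6 0 + patternSums.getD 9 0 +
      patternSums.getD 10 0 + patternSums.getD 12 0 = 8 := by
  rw [patternSums_eq]; decide

/-- The whole single-`d` sum `dSignSum(4) = Σ_c S(c) = −24 ≤ 0`, as the general statement predicts. -/
theorem dSignSum_eq : patternSums.sum = -24 := by rw [patternSums_eq]; decide

end Summit.Ventures.PercRepro2.SliceCounterexample
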